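import Summits.QuantumFields.YangMills.Theorems.AllWindowsColdBoxBoxMidLineWindow
import Summits.QuantumFields.YangMills.Theorems.ColdBoxAllGroupsBoxFloorAllGroupsGaussTailD
import Summits.QuantumFields.YangMills.Theorems.ColdBoxAllGroupsBoxFloorAllGroupsChartWindowG
import Summits.QuantumFields.YangMills.Theorems.ColdBoxAllGroupsBoxFloorAllGroupsCoreG
import Summits.QuantumFields.YangMills.Theorems.WeakCouplingRatesColdBoxDirichletPosDef
import Summits.QuantumFields.YangMills.Theorems.WeakCouplingRatesColdBoxDirichletRestrictedCov
import Literature.Probability.Distributions.GaussianLinearCompensation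
import Mathlib.Probability.ConditionalProbability
import Mathlib.MeasureTheory.Function.LpSeminorm.CompareExp
import HarnessLib

/-!
# LINE-17 «hypercontractive second-order tilt expansion» on crux `AllWindowsColdBox.BoxMidWindowsSU22` (stmt-QuantumFields-24003):
# the `ν = lineGauss` toolkit — parity, bad mass, conditioning comparisons, centring

Shared plumbing for the two open stubs E `stub_tiltMoments` and F `stub_gaussSideTerms` of the critic-PASSed LINE-17 (skeleton v3, sha16
`4747b363e792659d`), following the planner's STUB-PLAN-E-24003 §2 E(6) «conditioning and centring» and §5 «PARITY LEMMA» /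
«CONDITIONING TRANSFER».  Here `γ = gaussD ⌈β^θ⌉ D` (`D = dimE ρ₂`) is the Gaussian reference and `ν = lineGauss θ β = γ[|lineEvent θ β]`.

* §Parity: `γ` is invariant under `t ↦ −t` (`boxDirichlet = N(0, Q_D⁻¹)` via the Literature lemma `multivariateGaussian_map_matrix` at
  `T = −1`, then `Measure.pi_map_pi`); odd observables and even·odd products have `γ`-mean `0`.
* §Cond (abstract, any measure `μ` and event `E`): `μ[|E] ≤ (μ E)⁻¹ • μ`; integrability / `L^p` transfer to `μ[|E]`; if `μ.real E ≥ 1/2`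
  then `μ[|E] ≤ 2 • μ`, `∫ X dμ[|E] ≤ 2 ∫ X dμ` for `X ≥ 0`, `|∫ X dμ[|E]| ≤ 2 ∫ |X| dμ`; `∫ X dμ[|E] = (μ.real E)⁻¹ ∫_E X dμ`.
  (The mean / covariance TRANSFER inequalities are the tree's `abs_integral_sub_integral_cond_le_of_sq` and `abs_cov_sub_cov_cond_le_of_fourth`.)
* §Centring (abstract, probability space): `‖X − ∫X‖_p ≤ 2‖X‖_p` and its even-moment form
  `(∫ (X − ∫X)^{2m})^{1/(2m)} ≤ 2 (∫ X^{2m})^{1/(2m)}`.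
* §Event: `lineEvent θ β` is measurable, `ν`-a.e. point lies in it, and — eventually in `β`, for `0 < θ ≤ 1/16` — its `γ`-complement has
  mass `≤ 240·D·(2H+1)⁴·e^{−β^{2θ}/2} ≤ 1/β^k` (every `k`), hence `≤ 1/2`; so `γ(lineEvent) ≠ 0` and `ν` is a probability measure
  (Gaussian tail `gaussD_real_compl_goodTE_inter_ball_le` at the free radius `R = β^θ` + the exponent window `eventually_lineWindow`).
* §LineGauss: the eventual `ν`-package and the specialised comparisons (`∫ X dν ≤ 2∫ X dγ`, mean transfer and covariance transfer with
  `η = 1/β^k`).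

HONEST LABEL: helper lemmas toward two OPEN stubs of one critic-PASSed line on the R2ξ″ RECORD-rung crux 24003; no stub, crux, rung or summit
is proved here; the Yang–Mills mass gap is NOT proved by this file.
-/

set_option autoImplicit false

noncomputable section

open MeasureTheory ProbabilityTheory
open scoped ENNReal
open Literature.MathematicalPhysics.QuantumLattice
open Literature.MathematicalPhysics.QuantumFieldTheory
open Literature.MathematicalPhysics.QuantumFieldTheory.LatticeMaxwell
open Summit.QuantumFields.YangMills.Theorems.WeakCouplingRates
open Summit.QuantumFields.YangMills.Theorems.ColdBoxAllGroups
open Summit.QuantumFields.YangMills.Theorems.FreeEnergyLogCoefficient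

namespace Summit.QuantumFields.YangMills.Theorems.AllWindowsColdBoxBoxMidLine

section Parity

open Literature.Probability.Distributions (matrixCLM multivariateGaussian_map_matrix ofLp_matrixCLM)

/-- A centred multivariate Gaussian with positive semidefinite covariance is invariant under `x ↦ −x`. -/
theorem multivariateGaussian_zero_map_neg {ι : Type} [Fintype ι] [DecidableEq ι] {S : Matrix ι ι ℝ} (hS : S.PosSemidef) :
    (multivariateGaussian (0 : EuclideanSpace ℝ ι) S).map (fun x => -x) = multivariateGaussian 0 S := by
  have hfun : (fun x : EuclideanSpace ℝ ι => -x) = matrixCLM (-1 : Matrix ι ι ℝ) := by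
    funext x
    apply (WithLp.ofLp_injective (p := 2))
    rw [ofLp_matrixCLM, Matrix.neg_mulVec, Matrix.one_mulVec, WithLp.ofLp_neg]
  rw [hfun, multivariateGaussian_map_matrix hS]
  simp

/-- **Parity of the Dirichlet Gaussian**: `boxDirichlet H` (= `N(0, Q_D⁻¹)`) is invariant under `s ↦ −s`. -/
theorem boxDirichlet_map_neg (H : ℕ) : (boxDirichlet H).map (fun s => -s) = boxDirichlet H := by
  have hS : ((Qmat (fun e => e ∉ dirFreeEdges H) dirCorner (2 * H + 3))⁻¹).PosSemidef := (posDef_dirQmat H).inv.posSemidef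
  exact multivariateGaussian_zero_map_neg hS

/-- **Parity of the `D`-colour Gaussian reference**: `gaussD H D` is invariant under `t ↦ −t`. -/
theorem gaussD_map_neg (H D : ℕ) : (gaussD H D).map (fun t => -t) = gaussD H D := by
  have h := Measure.pi_map_pi (μ := fun _ : Fin D => boxDirichlet H) (f := fun (_ : Fin D) (s : EuclideanSpace ℝ (DirFree H)) => -s)
    (fun _ => measurable_neg.aemeasurable)
  have hfun : (fun (t : TSpaceD H D) (i : Fin D) => -t i) = fun t => -t := by funext t; rfl
  rw [hfun] at h
  rw [h]
  simp_rw [boxDirichlet_map_neg]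

/-- Change of variables `t ↦ −t` under `gaussD`: `∫ X(−t) = ∫ X(t)`. -/
theorem integral_gaussD_comp_neg (H D : ℕ) (X : TSpaceD H D → ℝ) : ∫ t, X (-t) ∂(gaussD H D) = ∫ t, X t ∂(gaussD H D) := by
  haveI : MeasurableNeg (TSpaceD H D) := ⟨measurable_pi_lambda _ fun i => (measurable_pi_apply i).neg⟩
  have h := integral_map_equiv (MeasurableEquiv.neg (TSpaceD H D)) (μ := gaussD H D) X
  rw [show ((MeasurableEquiv.neg (TSpaceD H D)) : TSpaceD H D → TSpaceD H D) = fun t => -t from rfl, gaussD_map_neg] at h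
  exact h.symm

/-- **Odd observables have Gaussian mean zero**: if `X(−t) = −X(t)` for all `t` then `∫ X d(gaussD) = 0`. -/
theorem integral_gaussD_eq_zero_of_odd (H D : ℕ) {X : TSpaceD H D → ℝ} (hX : ∀ t, X (-t) = -X t) :
    ∫ t, X t ∂(gaussD H D) = 0 := by
  have h := integral_gaussD_comp_neg H D X
  simp_rw [hX, integral_neg] at h
  linarith

/-- Even times odd has Gaussian mean zero. -/
theorem integral_gaussD_even_mul_odd (H D : ℕ) {X Y : TSpaceD H D → ℝ} (hX : ∀ t, X (-t) = X t) (hY : ∀ t, Y (-t) = -Y t) :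
    ∫ t, X t * Y t ∂(gaussD H D) = 0 :=
  integral_gaussD_eq_zero_of_odd H D fun t => by rw [hX, hY, mul_neg]

end Parity

section Cond

variable {Ω : Type*} [MeasurableSpace Ω] {μ : Measure Ω} {E : Set Ω}

/-- The conditioned measure is dominated by `(μ E)⁻¹ • μ`. -/
theorem cond_le_inv_smul (μ : Measure Ω) (E : Set Ω) : μ[|E] ≤ (μ E)⁻¹ • μ := by
  rw [ProbabilityTheory.cond]
  refine Measure.le_iff.2 fun s hs => ?_
  rw [Measure.smul_apply, Measure.smul_apply, Measure.restrict_apply hs]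
  exact mul_le_mul_right (measure_mono Set.inter_subset_left) _

/-- If `μ.real E ≥ 1/2` then `(μ E)⁻¹ ≤ 2` (as an extended nonnegative real). -/
theorem inv_measure_le_two_of_half_le (hE : 1 / 2 ≤ μ.real E) : (μ E)⁻¹ ≤ 2 := by
  have hE0 : μ E ≠ 0 := by
    intro h; rw [measureReal_def, h, ENNReal.toReal_zero] at hE; norm_num at hE
  have h2 : (2 : ℝ≥0∞)⁻¹ ≤ μ E := by
    by_cases htop : μ E = ∞
    · rw [htop]; exact le_top
    rw [← ENNReal.ofReal_toReal htop, show (2 : ℝ≥0∞)⁻¹ = ENNReal.ofReal (1 / 2) by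
      rw [one_div, ENNReal.ofReal_inv_of_pos (by norm_num : (0:ℝ) < 2), ENNReal.ofReal_ofNat]]
    exact ENNReal.ofReal_le_ofReal hE
  calc (μ E)⁻¹ ≤ ((2 : ℝ≥0∞)⁻¹)⁻¹ := ENNReal.inv_le_inv.2 h2
    _ = 2 := inv_inv _

/-- Integrability passes to the conditioned measure (when the event is not null). -/
theorem integrable_cond_of_integrable (hE0 : μ E ≠ 0) {X : Ω → ℝ} (hX : Integrable X μ) : Integrable X (μ[|E]) :=
  (hX.smul_measure (ENNReal.inv_ne_top.2 hE0)).mono_measure (cond_le_inv_smul μ E)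

/-- `L^p` membership passes to the conditioned measure (when the event is not null). -/
theorem memLp_cond_of_memLp (hE0 : μ E ≠ 0) {X : Ω → ℝ} {p : ℝ≥0∞} (hX : MemLp X p μ) : MemLp X p (μ[|E]) :=
  (hX.smul_measure (ENNReal.inv_ne_top.2 hE0)).mono_measure (cond_le_inv_smul μ E)

/-- If `μ.real E ≥ 1/2`, the conditioned measure is dominated by `2 • μ`. -/
theorem cond_le_two_smul (hE : 1 / 2 ≤ μ.real E) : μ[|E] ≤ (2 : ℝ≥0∞) • μ := by
  refine (cond_le_inv_smul μ E).trans (Measure.le_iff.2 fun s _ => ?_)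
  rw [Measure.smul_apply, Measure.smul_apply]
  exact mul_le_mul_left (inv_measure_le_two_of_half_le hE) _

/-- **Conditioning on a likely event at most doubles nonnegative integrals**: if `μ.real E ≥ 1/2`, `X ≥ 0` a.e. and `X` is integrable,
then `∫ X dμ[|E] ≤ 2 ∫ X dμ`. -/
theorem integral_cond_le_two_mul (hE : 1 / 2 ≤ μ.real E) {X : Ω → ℝ} (hX0 : 0 ≤ᵐ[μ] X) (hX : Integrable X μ) :
    ∫ ω, X ω ∂(μ[|E]) ≤ 2 * ∫ ω, X ω ∂μ := by
  have h := integral_mono_measure (cond_le_two_smul hE) (Measure.ae_smul_measure hX0 _) (hX.smul_measure (by simp))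
  rwa [integral_smul_measure, ENNReal.toReal_ofNat, smul_eq_mul] at h

/-- Signed form: `|∫ X dμ[|E]| ≤ 2 ∫ |X| dμ` when `μ.real E ≥ 1/2` and `X` is integrable. -/
theorem abs_integral_cond_le_two_mul (hE : 1 / 2 ≤ μ.real E) {X : Ω → ℝ} (hX : Integrable X μ) :
    |∫ ω, X ω ∂(μ[|E])| ≤ 2 * ∫ ω, |X ω| ∂μ :=
  (abs_integral_le_integral_abs).trans (integral_cond_le_two_mul hE (ae_of_all _ fun _ => abs_nonneg _) hX.abs)

/-- The conditioned integral as a restricted integral: `∫ X dμ[|E] = (μ.real E)⁻¹ · ∫_E X dμ`. -/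
theorem integral_cond_eq_inv_mul_setIntegral (X : Ω → ℝ) :
    ∫ ω, X ω ∂(μ[|E]) = (μ.real E)⁻¹ * ∫ ω in E, X ω ∂μ := by
  rw [ProbabilityTheory.cond, integral_smul_measure, ENNReal.toReal_inv, smul_eq_mul, measureReal_def]

end Cond

section Centring

variable {Ω : Type*} [MeasurableSpace Ω] {ν : Measure Ω}

/-- Even moments as `L^{2m}` norms: `(∫ Y^{2m} dν)^{1/(2m)} = ‖Y‖_{L^{2m}(ν)}` for `Y ∈ L^{2m}`. -/
theorem moment_rpow_eq_toReal_eLpNorm {Y : Ω → ℝ} {m : ℕ} (hm : m ≠ 0) (hY : MemLp Y (2 * m : ℕ) ν) :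
    (∫ ω, Y ω ^ (2 * m) ∂ν) ^ (1 / (2 * m : ℝ)) = (eLpNorm Y (2 * m : ℕ) ν).toReal := by
  have hp0 : ((2 * m : ℕ) : ℝ≥0∞) ≠ 0 := by exact_mod_cast (by omega : 2 * m ≠ 0)
  have hpr : ((2 * m : ℕ) : ℝ≥0∞).toReal = (2 * m : ℝ) := by simp
  rw [hY.eLpNorm_eq_integral_rpow_norm hp0 ENNReal.coe_ne_top, hpr]
  have hint : ∫ ω, ‖Y ω‖ ^ (2 * m : ℝ) ∂ν = ∫ ω, Y ω ^ (2 * m) ∂ν := by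
    refine integral_congr_ae (ae_of_all _ fun ω => ?_)
    simp only [Real.norm_eq_abs]
    rw [show (2 * m : ℝ) = ((2 * m : ℕ) : ℝ) by push_cast; ring, Real.rpow_natCast]
    exact (show Even (2 * m) from even_two_mul m).pow_abs _
  rw [hint, ENNReal.toReal_ofReal (Real.rpow_nonneg (integral_nonneg fun ω => (even_two_mul m).pow_nonneg _) _), one_div]

variable [IsProbabilityMeasure ν]

/-- On a probability space the `L^p` norm of the constant `∫ X dν` is at most `‖X‖_{L^p}` (`1 ≤ p`). -/
theorem eLpNorm_const_integral_le {X : Ω → ℝ} (hX : AEStronglyMeasurable X ν) {p : ℝ≥0∞} (hp : 1 ≤ p) :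
    eLpNorm (fun _ : Ω => ∫ ω, X ω ∂ν) p ν ≤ eLpNorm X p ν := by
  have hp0 : p ≠ 0 := (zero_lt_one.trans_le hp).ne'
  rw [eLpNorm_const _ hp0 (NeZero.ne ν), measure_univ, ENNReal.one_rpow, mul_one]
  calc ‖∫ ω, X ω ∂ν‖ₑ ≤ ∫⁻ ω, ‖X ω‖ₑ ∂ν := enorm_integral_le_lintegral_enorm _
    _ = eLpNorm X 1 ν := (eLpNorm_one_eq_lintegral_enorm).symm
    _ ≤ eLpNorm X p ν := eLpNorm_le_eLpNorm_of_exponent_le hp hX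

/-- **Centring at most doubles `L^p` norms** on a probability space: `‖X − ∫X dν‖_p ≤ 2‖X‖_p` (`1 ≤ p`). -/
theorem eLpNorm_sub_integral_le {X : Ω → ℝ} (hX : AEStronglyMeasurable X ν) {p : ℝ≥0∞} (hp : 1 ≤ p) :
    eLpNorm (fun ω => X ω - ∫ ω', X ω' ∂ν) p ν ≤ 2 * eLpNorm X p ν := by
  calc eLpNorm (fun ω => X ω - ∫ ω', X ω' ∂ν) p ν
      = eLpNorm (X - fun _ : Ω => ∫ ω', X ω' ∂ν) p ν := rfl
    _ ≤ eLpNorm X p ν + eLpNorm (fun _ : Ω => ∫ ω', X ω' ∂ν) p ν := eLpNorm_sub_le hX aestronglyMeasurable_const hp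
    _ ≤ eLpNorm X p ν + eLpNorm X p ν := add_le_add le_rfl (eLpNorm_const_integral_le hX hp)
    _ = 2 * eLpNorm X p ν := (two_mul _).symm

/-- **Centred even moments**: on a probability space, for `X ∈ L^{2m}` (`m ≥ 1`),
`(∫ (X − ∫X dν)^{2m} dν)^{1/(2m)} ≤ 2·(∫ X^{2m} dν)^{1/(2m)}`. -/
theorem centredMoment_rpow_le {X : Ω → ℝ} {m : ℕ} (hm : m ≠ 0) (hX : MemLp X (2 * m : ℕ) ν) :
    (∫ ω, (X ω - ∫ ω', X ω' ∂ν) ^ (2 * m) ∂ν) ^ (1 / (2 * m : ℝ)) ≤ 2 * (∫ ω, X ω ^ (2 * m) ∂ν) ^ (1 / (2 * m : ℝ)) := by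
  have hXc : MemLp (fun ω => X ω - ∫ ω', X ω' ∂ν) (2 * m : ℕ) ν := hX.sub (memLp_const _)
  rw [moment_rpow_eq_toReal_eLpNorm hm hXc, moment_rpow_eq_toReal_eLpNorm hm hX,
    show (2 : ℝ) * (eLpNorm X (2 * m : ℕ) ν).toReal = ((2 : ℝ≥0∞) * eLpNorm X (2 * m : ℕ) ν).toReal by
      rw [ENNReal.toReal_mul, ENNReal.toReal_ofNat]]
  have hp1 : (1 : ℝ≥0∞) ≤ ((2 * m : ℕ) : ℝ≥0∞) := by exact_mod_cast (by omega : 1 ≤ 2 * m)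
  exact ENNReal.toReal_mono (ENNReal.mul_ne_top ENNReal.ofNat_ne_top hX.eLpNorm_ne_top) (eLpNorm_sub_integral_le hX.1 hp1)

end Centring

section Event

open Filter Topology

/-- The conditioning event of the line is measurable. -/
theorem measurableSet_lineEvent (θ β : ℝ) : MeasurableSet (lineEvent θ β) := by
  haveI : SecondCountableTopology (Matrix (Fin 2) (Fin 2) ℂ) := inferInstanceAs (SecondCountableTopology (Fin 2 → Fin 2 → ℂ))
  haveI : SecondCountableTopology SU2 := inferInstance
  exact (measurableSet_goodTE ρ₂ (continuous_fundamentalRep (Fin 2)) (fundamentalRep_injective (Fin 2)) β (epsOf θ)).inter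
    (measurableSet_ball_unscaleTE (dimE ρ₂) β (2 * etaOf β ⌈β ^ θ⌉₊ (epsOf θ)))

/-- `lineGauss`-almost every point lies in the conditioning event. -/
theorem ae_mem_lineEvent (θ β : ℝ) : ∀ᵐ t ∂(lineGauss θ β), t ∈ lineEvent θ β :=
  ae_cond_mem (measurableSet_lineEvent θ β)

/-- **The Gaussian bad mass of the line's event** (eventually in `β`, for `0 < θ ≤ 1/16`): `1 ≤ β`, and the complement of
`lineEvent θ β` has `gaussD`-mass at most `240·D·(2H+1)⁴·e^{−β^{2θ}/2} ≤ 1/β^k` (`H = ⌈β^θ⌉`, `D = dimE ρ₂`; any fixed `k`). -/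
theorem eventually_gaussD_real_compl_lineEvent_le {θ : ℝ} (hθ : 0 < θ) (hθ16 : θ ≤ 1 / 16) (k : ℕ) :
    ∃ β₀ : ℝ, ∀ β : ℝ, β₀ ≤ β → 1 ≤ β ∧
      (gaussD ⌈β ^ θ⌉₊ (dimE ρ₂)).real (lineEvent θ β)ᶜ ≤
        240 * (dimE ρ₂ : ℝ) * (2 * (⌈β ^ θ⌉₊ : ℝ) + 1) ^ 4 * Real.exp (-(β ^ θ) ^ 2 / 2) ∧
      240 * (dimE ρ₂ : ℝ) * (2 * (⌈β ^ θ⌉₊ : ℝ) + 1) ^ 4 * Real.exp (-(β ^ θ) ^ 2 / 2) ≤ 1 / β ^ k := by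
  have hε : 0 < epsOf θ := by unfold epsOf; linarith
  -- the exponent window of the line (link radius below `2η`, cubic Gaussian window)
  obtain ⟨b₁, hwinE⟩ := eventually_lineWindow hθ hθ16 0
  -- `2η ≤ 1/4`: `8·(12H²+2H+1)·√2·β^{ε−1/2} ≤ 1`
  obtain ⟨b₂, hb₂1, h₂⟩ := exists_const_mul_boxSide_pow_mul_rpow_le (8 * 3 * Real.sqrt 2) 2 (θ := θ) (a := epsOf θ - 1 / 2) (b := 0) hθ
    (by unfold epsOf; push_cast; linarith)
  -- the bad mass against `β^{-k}`, and `β^θ ≥ 2`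
  obtain ⟨b₃, hb₃1, h₃⟩ := exists_const_mul_boxSide_pow_mul_exp_neg_le (240 * (dimE ρ₂ : ℝ)) 4 hθ.le hθ (-(k : ℝ))
  obtain ⟨b₄, hb₄1, h₄⟩ := exists_const_mul_rpow_le_rpow (2 : ℝ) (a := 0) (b := θ) hθ
  refine ⟨max (max b₁ b₂) (max b₃ b₄), fun β hβ => ?_⟩
  have hβ₁ : b₁ ≤ β := le_trans (le_trans (le_max_left _ _) (le_max_left _ _)) hβ
  have hβ₂ : b₂ ≤ β := le_trans (le_trans (le_max_right _ _) (le_max_left _ _)) hβ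
  have hβ₃ : b₃ ≤ β := le_trans (le_trans (le_max_left _ _) (le_max_right _ _)) hβ
  have hβ₄ : b₄ ≤ β := le_trans (le_trans (le_max_right _ _) (le_max_right _ _)) hβ
  obtain ⟨hβ1, hmEm, hwin, -, -, -⟩ := hwinE β hβ₁
  have hβ0 : 0 < β := by linarith
  have hHr : (1 : ℝ) ≤ (⌈β ^ θ⌉₊ : ℝ) := (one_le_ceil_rpow_and_le hβ1 hθ.le).1
  have hH : 1 ≤ ⌈β ^ θ⌉₊ := by exact_mod_cast hHr
  have hR0 : (0 : ℝ) ≤ β ^ θ := Real.rpow_nonneg hβ0.le _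
  -- `2η ≤ 1/4`
  have hm4 : 2 * etaOf β ⌈β ^ θ⌉₊ (epsOf θ) ≤ 1 / 4 := by
    have h := h₂ β hβ₂
    rw [Real.rpow_zero] at h
    have hP : 12 * (⌈β ^ θ⌉₊ : ℝ) ^ 2 + 2 * ⌈β ^ θ⌉₊ + 1 ≤ 3 * (2 * (⌈β ^ θ⌉₊ : ℝ) + 3) ^ 2 := by nlinarith
    have hsq : Real.sqrt (β ^ (2 * epsOf θ - 1)) = β ^ (epsOf θ - 1 / 2) := by
      rw [Real.sqrt_eq_rpow, ← Real.rpow_mul hβ0.le]; congr 1; ring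
    unfold etaOf
    rw [hsq]
    have hx0 : 0 ≤ Real.sqrt 2 * β ^ (epsOf θ - 1 / 2) := by positivity
    have := mul_le_mul_of_nonneg_right hP hx0
    nlinarith
  have hmE4 : Real.sqrt (dimE ρ₂) * ((12 * (⌈β ^ θ⌉₊ : ℝ) ^ 2 + 2 * ⌈β ^ θ⌉₊ + 1) * β ^ θ) / Real.sqrt β ≤ 1 / 4 := hmEm.trans hm4
  have hpS : (gaussD ⌈β ^ θ⌉₊ (dimE ρ₂)).real (lineEvent θ β)ᶜ ≤
      240 * (dimE ρ₂) * (2 * (⌈β ^ θ⌉₊ : ℝ) + 1) ^ 4 * Real.exp (-(β ^ θ) ^ 2 / 2) :=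
    gaussD_real_compl_goodTE_inter_ball_le ρ₂ (continuous_fundamentalRep (Fin 2)) hβ0 hH hR0 hmE4 hmEm hwin
  refine ⟨hβ1, hpS, ?_⟩
  -- `240·D·(2H+1)⁴·e^{−β^{2θ}/2} ≤ 240·D·(2H+3)⁴·e^{−β^θ} ≤ β^{−k} = 1/β^k`
  have h := h₃ β hβ₃
  rw [Real.rpow_neg hβ0.le, Real.rpow_natCast, inv_eq_one_div] at h
  have h2θ : 2 ≤ β ^ θ := by have := h₄ β hβ₄; rw [Real.rpow_zero, mul_one] at this; exact this
  have hexp : Real.exp (-(β ^ θ) ^ 2 / 2) ≤ Real.exp (-(β ^ θ)) := by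
    refine Real.exp_le_exp.2 ?_
    have : β ^ θ ≤ (β ^ θ) ^ 2 / 2 := by nlinarith
    linarith
  have hH3 : (2 * (⌈β ^ θ⌉₊ : ℝ) + 1) ^ 4 ≤ (2 * (⌈β ^ θ⌉₊ : ℝ) + 3) ^ 4 := pow_le_pow_left₀ (by positivity) (by linarith) 4
  have hD0 : (0 : ℝ) ≤ 240 * (dimE ρ₂ : ℝ) := by positivity
  calc 240 * (dimE ρ₂ : ℝ) * (2 * (⌈β ^ θ⌉₊ : ℝ) + 1) ^ 4 * Real.exp (-(β ^ θ) ^ 2 / 2)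
      ≤ 240 * (dimE ρ₂ : ℝ) * (2 * (⌈β ^ θ⌉₊ : ℝ) + 3) ^ 4 * Real.exp (-(β ^ θ)) :=
        mul_le_mul (mul_le_mul_of_nonneg_left hH3 hD0) hexp (Real.exp_pos _).le (by positivity)
    _ ≤ 1 / β ^ k := h

/-- **Corollary: the event is likely** (eventually in `β`): `gaussD`-mass of the complement `≤ 1/2`, of the event `≥ 1/2`, the event is
not null, and `lineGauss θ β` is a probability measure. -/
theorem eventually_lineEvent_likely {θ : ℝ} (hθ : 0 < θ) (hθ16 : θ ≤ 1 / 16) :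
    ∃ β₀ : ℝ, ∀ β : ℝ, β₀ ≤ β → 1 ≤ β ∧
      (gaussD ⌈β ^ θ⌉₊ (dimE ρ₂)).real (lineEvent θ β)ᶜ ≤ 1 / 2 ∧
      1 / 2 ≤ (gaussD ⌈β ^ θ⌉₊ (dimE ρ₂)).real (lineEvent θ β) ∧
      (gaussD ⌈β ^ θ⌉₊ (dimE ρ₂)) (lineEvent θ β) ≠ 0 ∧
      IsProbabilityMeasure (lineGauss θ β) := by
  obtain ⟨β₀, h⟩ := eventually_gaussD_real_compl_lineEvent_le hθ hθ16 1
  refine ⟨max β₀ 2, fun β hβ => ?_⟩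
  obtain ⟨hβ1, hc, hk⟩ := h β ((le_max_left _ _).trans hβ)
  have hβ2 : 2 ≤ β := (le_max_right _ _).trans hβ
  haveI := isProbabilityMeasure_gaussD ⌈β ^ θ⌉₊ (dimE ρ₂)
  have hhalf : (gaussD ⌈β ^ θ⌉₊ (dimE ρ₂)).real (lineEvent θ β)ᶜ ≤ 1 / 2 := by
    refine hc.trans (hk.trans ?_)
    rw [pow_one]
    exact one_div_le_one_div_of_le (by norm_num) hβ2
  have hE : 1 / 2 ≤ (gaussD ⌈β ^ θ⌉₊ (dimE ρ₂)).real (lineEvent θ β) := by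
    have := probReal_compl_eq_one_sub (μ := gaussD ⌈β ^ θ⌉₊ (dimE ρ₂)) (measurableSet_lineEvent θ β)
    linarith
  have hne : (gaussD ⌈β ^ θ⌉₊ (dimE ρ₂)) (lineEvent θ β) ≠ 0 :=
    measure_ne_zero_of_real_compl_lt_one _ (measurableSet_lineEvent θ β) (by linarith)
  exact ⟨hβ1, hhalf, hE, hne, cond_isProbabilityMeasure hne⟩

end Event

section LineGauss

/-- **The eventual `ν`-package of the line** (`0 < θ ≤ 1/16`, any `k ≥ 1`): beyond a threshold, `1 ≤ β`, `ν = lineGauss θ β` is a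
probability measure, the event is not `γ`-null, `γ.real (lineEvent)ᶜ ≤ 1/β^k ≤ 1/2` and `γ.real (lineEvent) ≥ 1/2` (`γ = gaussD ⌈β^θ⌉ D`). -/
theorem eventually_lineGauss_package {θ : ℝ} (hθ : 0 < θ) (hθ16 : θ ≤ 1 / 16) {k : ℕ} (hk : 1 ≤ k) :
    ∃ β₀ : ℝ, ∀ β : ℝ, β₀ ≤ β → 1 ≤ β ∧ IsProbabilityMeasure (lineGauss θ β) ∧
      (gaussD ⌈β ^ θ⌉₊ (dimE ρ₂)) (lineEvent θ β) ≠ 0 ∧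
      (gaussD ⌈β ^ θ⌉₊ (dimE ρ₂)).real (lineEvent θ β)ᶜ ≤ 1 / β ^ k ∧ 1 / β ^ k ≤ 1 / 2 ∧
      1 / 2 ≤ (gaussD ⌈β ^ θ⌉₊ (dimE ρ₂)).real (lineEvent θ β) := by
  obtain ⟨β₁, h₁⟩ := eventually_gaussD_real_compl_lineEvent_le hθ hθ16 k
  obtain ⟨β₂, h₂⟩ := eventually_lineEvent_likely hθ hθ16
  refine ⟨max (max β₁ β₂) 2, fun β hβ => ?_⟩
  obtain ⟨hβ1, hc, hk'⟩ := h₁ β (le_trans (le_trans (le_max_left _ _) (le_max_left _ _)) hβ)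
  obtain ⟨-, -, hE, hne, hP⟩ := h₂ β (le_trans (le_trans (le_max_right _ _) (le_max_left _ _)) hβ)
  have hβ2 : 2 ≤ β := (le_max_right _ _).trans hβ
  have hη2 : 1 / β ^ k ≤ 1 / 2 := by
    refine one_div_le_one_div_of_le (by norm_num) ?_
    calc (2 : ℝ) = 2 ^ 1 := (pow_one 2).symm
      _ ≤ 2 ^ k := pow_le_pow_right₀ (by norm_num) hk
      _ ≤ β ^ k := pow_le_pow_left₀ (by norm_num) hβ2 k
  exact ⟨hβ1, hP, hne, hc.trans hk', hη2, hE⟩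

/-- **`ν`-integrals of nonnegative observables are at most twice the Gaussian ones**, eventually in `β`. -/
theorem eventually_integral_lineGauss_le_two_mul {θ : ℝ} (hθ : 0 < θ) (hθ16 : θ ≤ 1 / 16) :
    ∃ β₀ : ℝ, ∀ β : ℝ, β₀ ≤ β → ∀ X : TSpaceD ⌈β ^ θ⌉₊ (dimE ρ₂) → ℝ,
      0 ≤ᵐ[gaussD ⌈β ^ θ⌉₊ (dimE ρ₂)] X → Integrable X (gaussD ⌈β ^ θ⌉₊ (dimE ρ₂)) →
        ∫ t, X t ∂(lineGauss θ β) ≤ 2 * ∫ t, X t ∂(gaussD ⌈β ^ θ⌉₊ (dimE ρ₂)) := by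
  obtain ⟨β₀, h⟩ := eventually_lineGauss_package hθ hθ16 (le_refl 1)
  refine ⟨β₀, fun β hβ X hX0 hX => ?_⟩
  obtain ⟨-, -, -, -, -, hE⟩ := h β hβ
  exact integral_cond_le_two_mul hE hX0 hX

/-- **Mean transfer `γ → ν` with `η = 1/β^k`**, eventually in `β` (`k ≥ 1`): for `X ∈ L²(γ)`,
`|∫ X dγ − ∫ X dν| ≤ 2(1 + ∫ X² dγ)·√(1/β^k)` (the tree's `abs_integral_sub_integral_cond_le_of_sq`). -/
theorem eventually_abs_integral_gaussD_sub_lineGauss_le {θ : ℝ} (hθ : 0 < θ) (hθ16 : θ ≤ 1 / 16) {k : ℕ} (hk : 1 ≤ k) :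
    ∃ β₀ : ℝ, ∀ β : ℝ, β₀ ≤ β → ∀ X : TSpaceD ⌈β ^ θ⌉₊ (dimE ρ₂) → ℝ, MemLp X 2 (gaussD ⌈β ^ θ⌉₊ (dimE ρ₂)) →
      |(∫ t, X t ∂(gaussD ⌈β ^ θ⌉₊ (dimE ρ₂))) - ∫ t, X t ∂(lineGauss θ β)| ≤
        2 * (1 + ∫ t, X t ^ 2 ∂(gaussD ⌈β ^ θ⌉₊ (dimE ρ₂))) * Real.sqrt (1 / β ^ k) := by
  obtain ⟨β₀, h⟩ := eventually_lineGauss_package hθ hθ16 hk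
  refine ⟨β₀, fun β hβ X hX => ?_⟩
  obtain ⟨-, -, -, hη, hη2, -⟩ := h β hβ
  haveI := isProbabilityMeasure_gaussD ⌈β ^ θ⌉₊ (dimE ρ₂)
  exact abs_integral_sub_integral_cond_le_of_sq (measurableSet_lineEvent θ β) hX hη hη2

/-- **Covariance transfer `γ → ν` with `η = 1/β^k`**, eventually in `β` (`k ≥ 1`): for `f, g` with fourth moments under `γ`,
`|Cov_γ(f,g) − Cov_ν(f,g)| ≤ (2 + ∫f⁴ + ∫g⁴ + 6(1+∫f²)(1+∫g²))·√(1/β^k)` (the tree's `abs_cov_sub_cov_cond_le_of_fourth`). -/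
theorem eventually_abs_cov_gaussD_sub_cov_lineGauss_le {θ : ℝ} (hθ : 0 < θ) (hθ16 : θ ≤ 1 / 16) {k : ℕ} (hk : 1 ≤ k) :
    ∃ β₀ : ℝ, ∀ β : ℝ, β₀ ≤ β → ∀ f g : TSpaceD ⌈β ^ θ⌉₊ (dimE ρ₂) → ℝ,
      AEStronglyMeasurable f (gaussD ⌈β ^ θ⌉₊ (dimE ρ₂)) → AEStronglyMeasurable g (gaussD ⌈β ^ θ⌉₊ (dimE ρ₂)) →
      Integrable (fun t => f t ^ 4) (gaussD ⌈β ^ θ⌉₊ (dimE ρ₂)) → Integrable (fun t => g t ^ 4) (gaussD ⌈β ^ θ⌉₊ (dimE ρ₂)) →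
      |((∫ t, f t * g t ∂(gaussD ⌈β ^ θ⌉₊ (dimE ρ₂))) - (∫ t, f t ∂(gaussD ⌈β ^ θ⌉₊ (dimE ρ₂))) *
            (∫ t, g t ∂(gaussD ⌈β ^ θ⌉₊ (dimE ρ₂)))) -
          ((∫ t, f t * g t ∂(lineGauss θ β)) - (∫ t, f t ∂(lineGauss θ β)) * (∫ t, g t ∂(lineGauss θ β)))| ≤
        (2 + (∫ t, f t ^ 4 ∂(gaussD ⌈β ^ θ⌉₊ (dimE ρ₂))) + (∫ t, g t ^ 4 ∂(gaussD ⌈β ^ θ⌉₊ (dimE ρ₂))) +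
            6 * (1 + ∫ t, f t ^ 2 ∂(gaussD ⌈β ^ θ⌉₊ (dimE ρ₂))) * (1 + ∫ t, g t ^ 2 ∂(gaussD ⌈β ^ θ⌉₊ (dimE ρ₂)))) *
          Real.sqrt (1 / β ^ k) := by
  obtain ⟨β₀, h⟩ := eventually_lineGauss_package hθ hθ16 hk
  refine ⟨β₀, fun β hβ f g hf hg hf4 hg4 => ?_⟩
  obtain ⟨-, -, -, hη, hη2, -⟩ := h β hβ
  haveI := isProbabilityMeasure_gaussD ⌈β ^ θ⌉₊ (dimE ρ₂)
  exact abs_cov_sub_cov_cond_le_of_fourth (measurableSet_lineEvent θ β) hf hg hf4 hg4 hη hη2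

end LineGauss

end Summit.QuantumFields.YangMills.Theorems.AllWindowsColdBoxBoxMidLine

end
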